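import Mathlib

/-!
# The trace–rank bound `(tr A)² ≤ rank A · tr (A·A)` for real symmetric matrices
# (crux `LevelGradedCohnUmans.GradedDesignFamily`, stmt-MatrixMultiplication-7610; negative side,
# line `quadratic-extension-level-one-cell`, stub `trace_sq_le_rank_mul_trace_sq`)

For a real symmetric (`IsHermitian` with trivial star) matrix `A` with eigenvalues `λ_i`,

* `trace_sq_le_rank_mul_trace_sq` — `A.trace ^ 2 ≤ A.rank * (A * A).trace`.

Proof: by the spectral theorem `A = U D U⋆` (`Matrix.IsHermitian.spectral_theorem`, `U` unitary,
`D = diagonal λ`), so `tr A = Σ λ_i` (`Matrix.IsHermitian.trace_eq_sum_eigenvalues`),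
`rank A = #{i : λ_i ≠ 0}` (`Matrix.IsHermitian.rank_eq_card_non_zero_eigs`) and
`tr (A·A) = tr (U D² U⋆) = tr D² = Σ λ_i²` (`Matrix.trace_mul_cycle` kills the conjugation).  Restrict
the first sum to the nonzero eigenvalues (`Finset.sum_filter_ne_zero`) and apply the discrete
Cauchy–Schwarz inequality `(Σ_{i ∈ s} λ_i)² ≤ #s · Σ_{i ∈ s} λ_i²` (`sq_sum_le_card_mul_sum_sq`),
then enlarge the last sum to all indices (squares are nonnegative).

This is the engine of the "rank expansion" lemmas of the line's negative programme: applied to the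
Gram matrix `(q + 1) I + A_S` of a set `S` of lines of `PG(3, q)` it gives the first half of the
L1-row theorem (incidence rank `≥ (C / (C + 2)) (q³ + q²)` for `|S| ≥ C q³`).

Sorry-free; axioms `propext`, `Classical.choice`, `Quot.sound`.
-/

set_option linter.dupNamespace false

open scoped BigOperators

namespace Summit.MatrixMultiplication.MatrixMultiplication.Theorems.GradedDesignFamily.Negative

/-- `tr (A·A) = Σ λ_i²` for a real symmetric matrix `A` with eigenvalues `λ_i` (spectral theorem:
`A·A = U D² U⋆` and the trace is invariant under unitary conjugation). [folklore] -/
theorem trace_sq_le_rank_mul_trace_sq_trace_mul_self {n : Type} [Fintype n] [DecidableEq n]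
    {A : Matrix n n ℝ} (hA : A.IsHermitian) :
    (A * A).trace = ∑ i, hA.eigenvalues i ^ 2 := by
  conv_lhs => rw [hA.spectral_theorem, ← map_mul, Unitary.conjStarAlgAut_apply,
    Matrix.trace_mul_cycle, Unitary.coe_star_mul_self, Matrix.one_mul,
    Matrix.diagonal_mul_diagonal, Matrix.trace_diagonal]
  simp only [Function.comp_apply, RCLike.ofReal_real_eq_id, id_eq, sq]

/-- **Trace–rank bound.**  For a real symmetric matrix `A` (i.e. `A.IsHermitian` with the trivial
star on `ℝ`), `(tr A)² ≤ rank A · tr (A·A)`: with eigenvalues `λ_i`, `tr A = Σ_{λ_i ≠ 0} λ_i`,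
`rank A = #{i : λ_i ≠ 0}`, `tr (A·A) = Σ λ_i²`, and Cauchy–Schwarz over the nonzero eigenvalues.
[folklore] -/
theorem trace_sq_le_rank_mul_trace_sq :
    ∀ {n : Type} [Fintype n] [DecidableEq n] (A : Matrix n n ℝ), A.IsHermitian →
      A.trace ^ 2 ≤ (A.rank : ℝ) * (A * A).trace := by
  intro n _ _ A hA
  -- `tr A = Σ λ`, `tr (A A) = Σ λ²`, `rank A = #{λ ≠ 0}`
  have htr : A.trace = ∑ i, hA.eigenvalues i := by
    rw [hA.trace_eq_sum_eigenvalues]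
    simp only [RCLike.ofReal_real_eq_id, id_eq]
  rw [htr, trace_sq_le_rank_mul_trace_sq_trace_mul_self hA, hA.rank_eq_card_non_zero_eigs,
    Fintype.card_subtype, ← Finset.sum_filter_ne_zero (Finset.univ : Finset n)]
  -- Cauchy–Schwarz over the nonzero eigenvalues, then enlarge `Σ_{λ ≠ 0} λ²` to `Σ λ²`
  calc (∑ i ∈ Finset.univ.filter (fun i => hA.eigenvalues i ≠ 0), hA.eigenvalues i) ^ 2
      ≤ ((Finset.univ.filter (fun i => hA.eigenvalues i ≠ 0)).card : ℝ) *
          ∑ i ∈ Finset.univ.filter (fun i => hA.eigenvalues i ≠ 0), hA.eigenvalues i ^ 2 :=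
        sq_sum_le_card_mul_sum_sq
    _ ≤ ((Finset.univ.filter (fun i => hA.eigenvalues i ≠ 0)).card : ℝ) *
          ∑ i, hA.eigenvalues i ^ 2 :=
        mul_le_mul_of_nonneg_left (Finset.sum_le_sum_of_subset_of_nonneg (Finset.subset_univ _)
          fun i _ _ => sq_nonneg (hA.eigenvalues i)) (Nat.cast_nonneg _)

end Summit.MatrixMultiplication.MatrixMultiplication.Theorems.GradedDesignFamily.Negative
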